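import Literature.NumberTheory.Automorphic.CDTTheorem712
import Literature.NumberTheory.Automorphic.BCDTTheoremBWildAtThreeDet
import Literature.NumberTheory.EllipticCurves.ModFiveCongruenceHesseFamily
import Literature.NumberTheory.EllipticCurves.VariableChangePointsMap
import Literature.NumberTheory.EllipticCurves.WeilPairingProofs
import Literature.NumberTheory.EllipticCurves.DivisionField
import Literature.NumberTheory.EllipticCurves.GoodReductionUnramifiedProofs
import Literature.NumberTheory.EllipticCurves.MultiplicativeUnramifiedTorsionProofs
import Literature.NumberTheory.GaloisRepresentations.AbsGaloisGroup
import Literature.NumberTheory.GaloisRepresentations.QuadraticInertia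
import Literature.NumberTheory.DiophantineGeometry.LocalReductionProofs
import Literature.NumberTheory.EllipticCurves.ModPIrreducibleCongruenceTransferProofs
import Summits.ABC.ABC.Theorems.DefiniteXiFreyModularityStubAbsIrrNegThreeGroup
import Summits.ABC.ABC.Theorems.DefiniteXiFreyModularityCDT
import HarnessLib

/-!
# stub_switch — k3 GENERATION 6 companion (FAMILY 3: probe the extremes)

Scratch sketch for `STUB-IDEAS-stub_switch-3.md` (gen 6).  NOT a proposal; every `sorry` is a
PROPOSED HELPER LEMMA with its recipe.  Road (unchanged, kernel-checked in g3/g4/g5 companions):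
`stub_switch ⇐ thm132(i) + Core1728 + FrobeniusCertificate`, `Core1728 ⇐ T0,T1,T2,G4″ + Thm132ii(ii)`.

What gen 6 adds (this file):
* §1 the CORE IN FIELD NORMAL FORM: `Core1728At c₄ c₆ ↔ Core1728Field c₄ c₆ :=
  ∃ root t₁ of 𝔠₆(·,1), 𝔠₄(t₁,1) ≠ 0, with √-3 ∉ ℚ(t₁, μ₄)` — PROVED here from two small Galois
  lemmas (also PROVED) — which makes the core directly machine-testable (kit job j344820).
* §2 the FAST LANE for the extremal (= only) call-site regime `W` semistable at `3`:
  `τ₀ ∈ I₃` ⇒ `τ₀⁵` is trivial on `W[5]` (unipotent inertia, PROVED here by transporting the tree's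
  LOCAL theorem `smul_smul_sub_eq_of_mem_inertia_of_hasMultiplicativeReductionAt` to the global
  inertia group, template `smul_eq_of_mem_inertia_of_hasMultiplicativeReductionAt_of_dvd_of_nsmul_eq_zero`)
  and on `E₁[5]`; then ANY symplectic `e : E₁[5] ≃ W[5]` is `Γ_{K₀}`-equivariant for
  `K₀ = ℚ(W[5], E₁[5])` (division-field API, PROVED), Fisher 13.2(ii) over `K₀` puts `t₁ ∈ K₀`, and
  `τ₀⁵` fixes `K₀`: `core1728At_of_fastLane` (PROVED from the named helpers).  No twists `E₉/E₋₃`,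
  no `SL₂(𝔽₅)` trichotomy, no TW/NEG transport in this regime.
* §3 the (ii) debt as ONE field-generic named fact `Thm132iiField` (Fisher: any perfect field of
  characteristic `∤ 30`), with k1's prime-field instance PROVED from it.
-/

noncomputable section

set_option linter.dupNamespace false
set_option linter.unusedVariables false

open scoped Classical NumberField Pointwise NNReal

namespace Summit.ABC.ABC.Cruxes.FreyModularity.StubSwitchK3g6

open Literature.NumberTheory.EllipticCurves Literature.NumberTheory.EllipticCurves.HesseFamilyFive
open Literature.NumberTheory.Automorphic Literature.NumberTheory.GaloisRepresentations
open Literature.NumberTheory.Automorphic.BCDT WeierstrassCurve IsDedekindDomain Field NumberField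
open IsDedekindDomain.HeightOneSpectrum

universe u

/-! ## §0 Context (verbatim g3/g4/g5, k1-g5) -/

/-- The member `E_{λ,μ}` of Fisher's direct Hesse family. -/
abbrev member (c₄ c₆ l m : ℚ) : WeierstrassCurve ℚ :=
  ⟨0, 0, 0, -27 * C4 c₄ c₆ l m, -54 * C6 c₄ c₆ l m⟩

/-- The `c₄c₆`-model `y² = x³ − 27c₄x − 54c₆`. -/
abbrev base (c₄ c₆ : ℚ) : WeierstrassCurve ℚ := ⟨0, 0, 0, -27 * c₄, -54 * c₆⟩

/-- `E₁ : y² = x³ + x` (`j = 1728`, conductor `64`, good at `3`). -/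
abbrev E₁ : WeierstrassCurve ℚ := ⟨0, 0, 0, 1, 0⟩

instance : E₁.IsElliptic :=
  ⟨isUnit_iff_ne_zero.mpr (by norm_num [E₁, WeierstrassCurve.Δ, WeierstrassCurve.b₂,
    WeierstrassCurve.b₄, WeierstrassCurve.b₆, WeierstrassCurve.b₈])⟩

/-- The gen-3/4 CORE (verbatim g4/g5). -/
def Core1728 : Prop :=
  ∀ (c₄ c₆ : ℤ), c₄ ^ 3 ≠ c₆ ^ 2 → c₆ ≠ 0 →
    ∃ (τ : Field.absoluteGaloisGroup ℚ) (t₁ : AlgebraicClosure ℚ),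
      (∀ s : AlgebraicClosure ℚ, s ^ 2 = -3 → τ • s = -s) ∧
      (∀ z : AlgebraicClosure ℚ, z ^ 4 = 1 → τ • z = z) ∧
      C6 (c₄ : AlgebraicClosure ℚ) c₆ t₁ 1 = 0 ∧ C4 (c₄ : AlgebraicClosure ℚ) c₆ t₁ 1 ≠ 0 ∧
      τ • t₁ = t₁

/-- Named fact (verbatim g3/g4): Fisher 13.2 (ii) over an intermediate field `K ⊆ ℚ̄`.
[Fisher2012Hessian Thm 13.2 (ii); RubinSilverberg1995 Thm 4.1/5.1] -/
def Thm132iiMemHesseFamily : Prop :=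
  ∀ (E E' : WeierstrassCurve ℚ) [E.IsElliptic] [E'.IsElliptic] (c₄ c₆ : ℚ)
    (K : IntermediateField ℚ (AlgebraicClosure ℚ)),
    E = ⟨0, 0, 0, -27 * c₄, -54 * c₆⟩ →
    (∃ e : E'.geomTorsion 5 ≃+ E.geomTorsion 5,
      (∀ σ : Field.absoluteGaloisGroup ℚ, (∀ x : AlgebraicClosure ℚ, x ∈ K → σ • x = x) →
        ∀ P : E'.geomTorsion 5, e (σ • P) = σ • e P) ∧
      ∀ P Q : E'.geomTorsion 5,
        weilPairingFun (W := E) (m := 5) (by norm_num) (e P : E.geomPoints) (e Q) =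
          weilPairingFun (W := E') (m := 5) (by norm_num) (P : E'.geomPoints) Q) →
    ∃ (l m : AlgebraicClosure ℚ), l ∈ K ∧ m ∈ K ∧ (l ≠ 0 ∨ m ≠ 0) ∧
      ∃ Cv : VariableChange (AlgebraicClosure ℚ),
        Cv • E'.map (algebraMap ℚ (AlgebraicClosure ℚ)) =
          ⟨0, 0, 0, -27 * C4 (c₄ : AlgebraicClosure ℚ) c₆ l m, -54 * C6 (c₄ : AlgebraicClosure ℚ) c₆ l m⟩

/-! ## §1 The core in FIELD NORMAL FORM (new; PROVED equivalence) -/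

/-- The pointwise conclusion of `Core1728` at integral invariants `(c₄, c₆)`. -/
def Core1728At (c₄ c₆ : ℤ) : Prop :=
  ∃ (τ : Field.absoluteGaloisGroup ℚ) (t₁ : AlgebraicClosure ℚ),
    (∀ s : AlgebraicClosure ℚ, s ^ 2 = -3 → τ • s = -s) ∧
    (∀ z : AlgebraicClosure ℚ, z ^ 4 = 1 → τ • z = z) ∧
    C6 (c₄ : AlgebraicClosure ℚ) c₆ t₁ 1 = 0 ∧ C4 (c₄ : AlgebraicClosure ℚ) c₆ t₁ 1 ≠ 0 ∧ τ • t₁ = t₁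

theorem core1728_iff : Core1728 ↔ ∀ c₄ c₆ : ℤ, c₄ ^ 3 ≠ c₆ ^ 2 → c₆ ≠ 0 → Core1728At c₄ c₆ :=
  Iff.rfl

/-- `ℚ(t₁, μ₄) ⊆ ℚ̄`. -/
def rootField (t₁ : AlgebraicClosure ℚ) : IntermediateField ℚ (AlgebraicClosure ℚ) :=
  IntermediateField.adjoin ℚ (insert t₁ {z : AlgebraicClosure ℚ | z ^ 4 = 1})

/-- **Core in field normal form**: some root `t₁` of `𝔠₆(c₄,c₆; ·,1)` off the cusps has
`√-3 ∉ ℚ(t₁, i)`.  Directly testable (PARI `polcompositum`, kit job j344820). -/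
def Core1728Field (c₄ c₆ : ℤ) : Prop :=
  ∃ t₁ : AlgebraicClosure ℚ, C6 (c₄ : AlgebraicClosure ℚ) c₆ t₁ 1 = 0 ∧
    C4 (c₄ : AlgebraicClosure ℚ) c₆ t₁ 1 ≠ 0 ∧
    ∀ s : AlgebraicClosure ℚ, s ^ 2 = -3 → s ∉ rootField t₁

/-- NF0 (PROVED): an element fixing every `x ∈ K` pointwise fixes `K ≤ Fix⟨σ⟩`. -/
theorem le_fixedField_zpowers {σ : Field.absoluteGaloisGroup ℚ}
    {K : IntermediateField ℚ (AlgebraicClosure ℚ)} (hK : ∀ x ∈ K, σ • x = x) :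
    K ≤ IntermediateField.fixedField (Subgroup.zpowers σ) := fun y hy =>
  (IntermediateField.mem_fixedField_iff _ _).mpr fun m hm =>
    MulAction.mem_stabilizer_iff.mp
      (Subgroup.zpowers_le.mpr (MulAction.mem_stabilizer_iff.mpr (hK y hy)) hm)

/-- NF1 (PROVED): `τ` fixing `t₁` and `μ₄` fixes `ℚ(t₁, μ₄)` pointwise. -/
theorem smul_eq_of_mem_rootField {τ : Field.absoluteGaloisGroup ℚ} {t₁ : AlgebraicClosure ℚ}
    (ht : τ • t₁ = t₁) (hz : ∀ z : AlgebraicClosure ℚ, z ^ 4 = 1 → τ • z = z)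
    {x : AlgebraicClosure ℚ} (hx : x ∈ rootField t₁) : τ • x = x := by
  have hle : rootField t₁ ≤ IntermediateField.fixedField (Subgroup.zpowers τ) := by
    rw [rootField, IntermediateField.adjoin_le_iff]
    intro y hy
    simp only [Set.mem_insert_iff, Set.mem_setOf_eq] at hy
    have hy' : τ • y = y := by
      rcases hy with rfl | hy
      · exact ht
      · exact hz y hy
    exact (IntermediateField.mem_fixedField_iff _ _).mpr fun m hm =>
      MulAction.mem_stabilizer_iff.mp
        (Subgroup.zpowers_le.mpr (MulAction.mem_stabilizer_iff.mpr hy') hm)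
  exact (IntermediateField.mem_fixedField_iff _ _).mp (hle hx) τ (Subgroup.mem_zpowers τ)

/-- SUPFIX (PROVED): fixing `K₁` and `K₂` pointwise fixes `K₁ ⊔ K₂` pointwise. -/
theorem smul_eq_of_mem_sup {σ : Field.absoluteGaloisGroup ℚ}
    {K₁ K₂ : IntermediateField ℚ (AlgebraicClosure ℚ)}
    (h₁ : ∀ x ∈ K₁, σ • x = x) (h₂ : ∀ x ∈ K₂, σ • x = x) {x : AlgebraicClosure ℚ}
    (hx : x ∈ K₁ ⊔ K₂) : σ • x = x :=
  (IntermediateField.mem_fixedField_iff _ _).mp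
    ((sup_le (le_fixedField_zpowers h₁) (le_fixedField_zpowers h₂)) hx) σ (Subgroup.mem_zpowers σ)

/-- NF2 (PROVED): if `s ∉ F` with `s² = -3` then some `σ ∈ Γ_F` negates `s`
(infinite Galois correspondence `InfiniteGalois.fixedField_fixingSubgroup`). [folklore] -/
theorem exists_fixing_smul_eq_neg (F : IntermediateField ℚ (AlgebraicClosure ℚ))
    {s : AlgebraicClosure ℚ} (hs : s ^ 2 = -3) (hsF : s ∉ F) :
    ∃ σ : Field.absoluteGaloisGroup ℚ, (∀ x ∈ F, σ • x = x) ∧ σ • s = -s := by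
  haveI : IsAlgClosure ℚ (AlgebraicClosure ℚ) := AlgebraicClosure.instIsAlgClosure ℚ
  haveI : IsGalois ℚ (AlgebraicClosure ℚ) := IsAlgClosure.isGalois ℚ (AlgebraicClosure ℚ)
  have h : s ∉ IntermediateField.fixedField F.fixingSubgroup := by
    rwa [InfiniteGalois.fixedField_fixingSubgroup]
  rw [IntermediateField.mem_fixedField_iff] at h
  simp only [not_forall] at h
  obtain ⟨σ, hσF, hσs⟩ := h
  refine ⟨σ, fun x hx => (IntermediateField.mem_fixingSubgroup_iff _ _).mp hσF x hx, ?_⟩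
  have h2 : (σ • s) ^ 2 = s ^ 2 := by
    rw [AlgEquiv.smul_def, ← map_pow, hs, map_neg, map_ofNat]
  rcases sq_eq_sq_iff_eq_or_eq_neg.mp h2 with h | h
  · exact absurd h hσs
  · exact h

/-- **NF (PROVED): `Core1728At c₄ c₆ ↔ Core1728Field c₄ c₆`.** -/
theorem core1728At_iff_field (c₄ c₆ : ℤ) : Core1728At c₄ c₆ ↔ Core1728Field c₄ c₆ := by
  constructor
  · rintro ⟨τ, t₁, hs, hz, h6, h4, ht⟩
    refine ⟨t₁, h6, h4, fun s hs2 hsF => ?_⟩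
    have h1 : τ • s = s := smul_eq_of_mem_rootField ht hz hsF
    have h2 : τ • s = -s := hs s hs2
    have hs0 : s = 0 := by
      have h3 : (2 : AlgebraicClosure ℚ) * s = 0 := by
        rw [two_mul]
        nth_rewrite 1 [← h1]
        rw [h2, neg_add_cancel]
      rcases mul_eq_zero.mp h3 with h | h
      · norm_num at h
      · exact h
    rw [hs0] at hs2
    norm_num at hs2
  · rintro ⟨t₁, h6, h4, hsF⟩
    obtain ⟨s₀, hs₀⟩ := IsAlgClosed.exists_pow_nat_eq (-3 : AlgebraicClosure ℚ) (by norm_num : 0 < 2)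
    obtain ⟨σ, hσF, hσs⟩ := exists_fixing_smul_eq_neg (rootField t₁) hs₀ (hsF s₀ hs₀)
    refine ⟨σ, t₁, fun s hs => ?_, fun z hz => hσF z ?_, h6, h4, hσF t₁ ?_⟩
    · have : s ^ 2 = s₀ ^ 2 := by rw [hs, hs₀]
      rcases sq_eq_sq_iff_eq_or_eq_neg.mp this with rfl | rfl
      · exact hσs
      · rw [smul_neg, hσs, neg_neg]
    · exact IntermediateField.subset_adjoin ℚ _
        (Set.mem_insert_of_mem t₁ (show z ∈ {z : AlgebraicClosure ℚ | z ^ 4 = 1} from hz))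
    · exact IntermediateField.subset_adjoin ℚ _ (Set.mem_insert _ _)

/-! ## §2 FAST LANE — the semistable-at-`3` regime (every Frey curve) -/

/-! ### 2a. small algebra (PROVED) -/

theorem pow_smul_eq_of_smul_eq {G α : Type*} [Monoid G] [MulAction G α] {g : G} {a : α}
    (h : g • a = a) (n : ℕ) : g ^ n • a = a := by
  induction n with
  | zero => rw [pow_zero, one_smul]
  | succ n ih => rw [pow_succ', mul_smul, ih, h]

/-- `(g − 1)² = 0 ⇒ gⁿ = 1 + n(g − 1)`. -/
theorem pow_smul_eq_add_nsmul {G M : Type*} [Monoid G] [AddCommGroup M] [DistribMulAction G M]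
    {g : G} {P : M} (h : g • (g • P - P) = g • P - P) (n : ℕ) :
    g ^ n • P = P + n • (g • P - P) := by
  induction n with
  | zero => rw [pow_zero, one_smul, zero_nsmul, add_zero]
  | succ n ih =>
    have hP : g • P = P + (g • P - P) := by abel
    have hQ : g ^ n • (g • P - P) = g • P - P := pow_smul_eq_of_smul_eq h n
    calc g ^ (n + 1) • P = g ^ n • (g • P) := by rw [pow_succ, mul_smul]
      _ = g ^ n • (P + (g • P - P)) := by rw [← hP]
      _ = P + n • (g • P - P) + (g • P - P) := by rw [smul_add, ih, hQ]
      _ = P + (n + 1) • (g • P - P) := by rw [succ_nsmul, add_assoc]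

/-- `τ s = -s ⇒ τ⁵ s = -s`. -/
theorem pow_five_smul_neg {τ : Field.absoluteGaloisGroup ℚ} {s : AlgebraicClosure ℚ}
    (h : τ • s = -s) : τ ^ 5 • s = -s := by
  have h2 : τ ^ 2 • s = s := by rw [pow_two, mul_smul, h, smul_neg, h, neg_neg]
  rw [show (5 : ℕ) = 1 + 2 + 2 from rfl, pow_add, pow_add, mul_smul, mul_smul, h2, h2, pow_one, h]

/-- FL1b (PROVED): a unipotent element has `τ⁵ = 1` on the `5`-torsion. -/
theorem pow_five_smul_eq_of_unipotent (W : WeierstrassCurve ℚ) {τ : Field.absoluteGaloisGroup ℚ}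
    (h : ∀ P : W.geomTorsion 5, τ • (τ • P - P) = τ • P - P) (P : W.geomTorsion 5) :
    τ ^ 5 • P = P := by
  have h5 : (5 : ℕ) • (τ • P - P) = 0 := by
    apply Subtype.ext
    rw [AddSubmonoidClass.coe_nsmul, ← natCast_zsmul, ZeroMemClass.coe_zero]
    exact (Submodule.mem_torsionBy_iff (5 : ℤ) (τ • P - P).1).mp (τ • P - P).2
  rw [pow_smul_eq_add_nsmul (h P) 5, h5, add_zero]

/-! ### 2b. unipotent inertia at a multiplicative place, GLOBAL inertia group (PROVED transport) -/

/-- **FL1a (PROVED here): at a multiplicative place `v ∤ p`, every `τ` in the GLOBAL inertia group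
`I_𝔓 ≤ Γ_ℚ` acts unipotently on the `p`-torsion: `τ(τP − P) = τP − P`.**  Transport of the tree's
local theorem `smul_smul_sub_eq_of_mem_inertia_of_hasMultiplicativeReductionAt` (`n = 1`) along an
embedding `ℚ̄ → ℚ̄_v` cutting out `𝔓` — verbatim the glue of
`smul_eq_of_mem_inertia_of_hasMultiplicativeReductionAt_of_dvd_of_nsmul_eq_zero`.
[SilvermanATAEC1994 V.4–V.5; SerreAbelianLadic1968 IV A.1.2; NeukirchANT1999 II (9.6)] -/
theorem smul_smul_sub_eq_of_mem_inertia_global (W : WeierstrassCurve ℚ) [W.IsElliptic]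
    {v : HeightOneSpectrum (𝓞 ℚ)} (hmult : W.HasMultiplicativeReductionAt v) {p : ℕ} (hp : p.Prime)
    (hpv : (p : 𝓞 ℚ) ∉ v.asIdeal) {𝔓 : Ideal (absIntegers (𝓞 ℚ) ℚ)} (h𝔓 : 𝔓 ∈ v.primesAbove)
    {τ : absoluteGaloisGroup ℚ} (hτ : τ ∈ 𝔓.inertia (absoluteGaloisGroup ℚ))
    {P : geomPoints W} (hP : p • P = 0) : τ • (τ • P - P) = τ • P - P := by
  obtain ⟨w, hw⟩ := v.exists_spectralValuation
  obtain ⟨𝔐, h𝔐⟩ := v.localPrimesAbove_nonempty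
  obtain ⟨g, hg⟩ := HeightOneSpectrum.exists_smul_eq_of_mem_primesAbove_holds
    (HeightOneSpectrum.primeBelow_mem_primesAbove
      (ι := closureEmb (K := ℚ) (v.adicCompletion ℚ)) h𝔐) h𝔓
  have hcomp := HeightOneSpectrum.primeBelow_comp (v := v)
    (ι := closureEmb (K := ℚ) (v.adicCompletion ℚ))
    (g⁻¹ : AlgebraicClosure ℚ ≃ₐ[ℚ] AlgebraicClosure ℚ) 𝔐
  set ι : AlgebraicClosure ℚ →ₐ[ℚ] AlgebraicClosure (v.adicCompletion ℚ) :=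
    (closureEmb (K := ℚ) (v.adicCompletion ℚ)).comp
      ((g⁻¹ : AlgebraicClosure ℚ ≃ₐ[ℚ] AlgebraicClosure ℚ) :
        AlgebraicClosure ℚ →ₐ[ℚ] AlgebraicClosure ℚ) with hι
  have h1 : 𝔓 = v.primeBelow ι 𝔐 := by
    refine Eq.trans ?_ hcomp.symm
    rw [← hg]
    exact congrArg (· • _) (inv_inv g).symm
  rw [h1] at hτ
  obtain ⟨σ, hσI, hσ⟩ :=
    IsDedekindDomain.HeightOneSpectrum.exists_mem_inertia_apply_eq_holds v ι h𝔐 hτ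
  have hres : resGalOfEmb ι σ = τ := resGalOfEmb_eq_of_apply_eq ι hσ
  have hequiv : ∀ Q : geomPoints W, pointsMapOfEmb W ι (τ • Q) = σ • pointsMapOfEmb W ι Q :=
    fun Q => by
      rw [← hres]
      exact pointsMapOfEmb_smul W ι σ Q
  have hunip : σ • (σ • pointsMapOfEmb W ι P - pointsMapOfEmb W ι P) =
      σ • pointsMapOfEmb W ι P - pointsMapOfEmb W ι P :=
    W.smul_smul_sub_eq_of_mem_inertia_of_hasMultiplicativeReductionAt hmult hp hpv (n := 1) le_rfl
      hw h𝔐 hσI (pointsMapOfEmb W ι P) (by rw [pow_one, ← map_nsmul, hP, map_zero])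
  apply pointsMapOfEmb_injective W ι
  rw [hequiv, map_sub, hequiv]
  exact hunip

/-- FL1a on `E[5] = geomTorsion W 5` (PROVED). -/
theorem smul_smul_sub_eq_geomTorsion_five (W : WeierstrassCurve ℚ) [W.IsElliptic]
    {v : HeightOneSpectrum (𝓞 ℚ)} (hmult : W.HasMultiplicativeReductionAt v)
    (hv5 : ((5 : ℕ) : 𝓞 ℚ) ∉ v.asIdeal) {𝔓 : Ideal (absIntegers (𝓞 ℚ) ℚ)} (h𝔓 : 𝔓 ∈ v.primesAbove)
    {τ : absoluteGaloisGroup ℚ} (hτ : τ ∈ 𝔓.inertia (absoluteGaloisGroup ℚ))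
    (P : W.geomTorsion 5) : τ • (τ • P - P) = τ • P - P := by
  apply Subtype.ext
  simp only [AddSubgroup.torsionBy.coe_smul, AddSubgroupClass.coe_sub]
  refine smul_smul_sub_eq_of_mem_inertia_global W hmult Nat.prime_five hv5 h𝔓 hτ ?_
  rw [← natCast_zsmul]
  exact (Submodule.mem_torsionBy_iff (5 : ℤ) P.1).mp P.2

/-- `3 ∈ v ⇒ 5 ∉ v` (`2·3 − 5 = 1`). -/
theorem five_not_mem_of_three_mem {v : HeightOneSpectrum (𝓞 ℚ)} (hv3 : ((3 : ℕ) : 𝓞 ℚ) ∈ v.asIdeal) :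
    ((5 : ℕ) : 𝓞 ℚ) ∉ v.asIdeal := by
  intro hv5
  have h1 : (1 : 𝓞 ℚ) ∈ v.asIdeal := by
    have := v.asIdeal.sub_mem (v.asIdeal.mul_mem_left 2 hv3) hv5
    convert this using 1
    push_cast
    norm_num
  exact v.isPrime.ne_top ((Ideal.eq_top_iff_one _).mpr h1)

/-- **FL1 (PROVED from the tree + FL1a/b): at a SEMISTABLE place above `3`, `τ⁵` is trivial on
`W[5]` for every `τ` in the global inertia group.**  Good case: Néron–Ogg–Shafarevich
(`smul_geomTorsion_eq_of_mem_inertia`); multiplicative case: unipotence. -/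
theorem pow_five_smul_eq_of_isSemistableAt (W : WeierstrassCurve ℚ) [W.IsElliptic]
    {v : HeightOneSpectrum (𝓞 ℚ)} (hv3 : ((3 : ℕ) : 𝓞 ℚ) ∈ v.asIdeal) (hW : W.IsSemistableAt v)
    {𝔓 : Ideal (absIntegers (𝓞 ℚ) ℚ)} (h𝔓 : 𝔓 ∈ v.primesAbove)
    {τ : absoluteGaloisGroup ℚ} (hτ : τ ∈ 𝔓.inertia (absoluteGaloisGroup ℚ))
    (P : W.geomTorsion 5) : τ ^ 5 • P = P := by
  have hv5 := five_not_mem_of_three_mem hv3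
  rcases hW with hgood | hmult
  · have h1 : τ • P = P :=
      W.smul_geomTorsion_eq_of_mem_inertia hgood (n := 5) (by exact_mod_cast hv5) h𝔓 hτ P
    exact pow_smul_eq_of_smul_eq h1 5
  · exact pow_five_smul_eq_of_unipotent W
      (fun Q => smul_smul_sub_eq_geomTorsion_five W hmult hv5 h𝔓 hτ Q) P

/-! ### 2c. the regime: `¬ 9 ∣ N_W` ⇔ semistable at `3`; invariance under `ℚ`-isomorphism -/

/-- XS bridge (tree PROVED — cite by name): `9 ∣ N_W ↔ W` additive at the place above `3` :=
`Summit.ABC.ABC.Theorems.sq_dvd_conductorNorm_iff_hasAdditiveReductionAt W Nat.prime_three hv`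
(file `DefiniteXiFreyModularityStubNineTransfer`, with `hv : primesEquiv v = 3` from `3 ∈ v` via
`Rat.HeightOneSpectrum.natGenerator_dvd_iff` / `natCast_mem_asIdeal_iff`); not imported here only
because that module is not in the farm snapshot this session. [SilvermanATAEC1994 IV.10.2(a)] -/
theorem nine_dvd_conductorNorm_iff_hasAdditiveReductionAt (W : WeierstrassCurve ℚ) [W.IsElliptic]
    {v : HeightOneSpectrum (𝓞 ℚ)} (hv3 : ((3 : ℕ) : 𝓞 ℚ) ∈ v.asIdeal) :
    9 ∣ W.conductorNorm ℤ ↔ W.HasAdditiveReductionAt v := by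
  sorry

/-- **FL0 (PROVED modulo the XS bridge): `¬ 9 ∣ N_W ⇒ W` semistable at the place above `3`**
(bridge + the local trichotomy `hasGoodReductionAt_or_hasMultiplicativeReductionAt_or_hasAdditiveReductionAt`). -/
theorem isSemistableAt_three_of_not_nine_dvd (W : WeierstrassCurve ℚ) [W.IsElliptic]
    (h9 : ¬ 9 ∣ W.conductorNorm ℤ) {v : HeightOneSpectrum (𝓞 ℚ)}
    (hv3 : ((3 : ℕ) : 𝓞 ℚ) ∈ v.asIdeal) : W.IsSemistableAt v := by
  have hadd : ¬ W.HasAdditiveReductionAt v :=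
    fun h => h9 ((nine_dvd_conductorNorm_iff_hasAdditiveReductionAt W hv3).mpr h)
  rcases W.hasGoodReductionAt_or_hasMultiplicativeReductionAt_or_hasAdditiveReductionAt v with h | h | h
  · exact Or.inl h
  · exact Or.inr h
  · exact absurd h hadd

/-- ISO (PROVED): semistability at `v` is invariant under a `ℚ`-change of variables
(tree facts `hasGoodReductionAt_smul_iff_holds`, `hasMultiplicativeReductionAt_smul_iff_holds`). -/
theorem isSemistableAt_smul_iff (W : WeierstrassCurve ℚ) [W.IsElliptic] (C : VariableChange ℚ)
    (v : HeightOneSpectrum (𝓞 ℚ)) : (C • W).IsSemistableAt v ↔ W.IsSemistableAt v :=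
  or_congr (hasGoodReductionAt_smul_iff_holds v W C) (hasMultiplicativeReductionAt_smul_iff_holds v W C)

/-- CALL-SITE REMARK (tree PROVED): the route's only consumer feeds Frey curves, `¬ 9 ∣ N`. -/
example {a b : ℤ} (hab : IsCoprime a b) (h0 : a * b * (a + b) ≠ 0) :=
  Summit.ABC.ABC.Theorems.not_nine_dvd_conductorNorm_freyCurve hab h0

/-! ### 2d. division fields: equivariance for free (PROVED) -/

/-- DIV1 (PROVED): `σ` fixing `ℚ(W[5])` pointwise acts trivially on `W[5]`. -/
theorem smul_torsion_eq_of_fixes_divisionField (W : WeierstrassCurve ℚ) [W.IsElliptic]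
    {σ : Field.absoluteGaloisGroup ℚ} (hσ : ∀ x ∈ W.divisionField 5, σ • x = x)
    (T : W.geomTorsion 5) : σ • T = T := by
  haveI : NeZero (5 : ℕ) := ⟨by norm_num⟩
  have hmem : σ ∈ ((W.divisionField 5).fixingSubgroup : Subgroup (absoluteGaloisGroup ℚ)) :=
    (IntermediateField.mem_fixingSubgroup_iff _ _).mpr hσ
  rw [W.fixingSubgroup_divisionField 5] at hmem
  exact (W.mem_fixingSubgroupOfModule_geomTorsion_iff 5).mp hmem T

/-- DIV2 (PROVED): conversely, trivial on `W[5]` ⇒ fixes `ℚ(W[5])` pointwise. -/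
theorem fixes_divisionField_of_smul_torsion_eq (W : WeierstrassCurve ℚ)
    {σ : Field.absoluteGaloisGroup ℚ} (hσ : ∀ T : W.geomTorsion 5, σ • T = T) :
    ∀ x ∈ W.divisionField 5, σ • x = x := fun x hx =>
  (W.mem_divisionField_iff 5).mp hx σ fun T => hσ T

/-! ### 2e. the remaining named helpers of the fast lane -/

/-- **FL2 = T0′ (S; g5's T0 with the inertia membership EXPOSED).**  Recipe (g5 §4): `v ∋ 3`,
`𝔓 ∈ v.primesAbove` (`primesAbove_nonempty`), `s₃² = 3`, `τ₀ ∈ I_𝔓` with `τ₀ s₃ = -s₃`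
(`exists_mem_inertia_smul_eq_neg_of_sq_eq_prime Nat.prime_three`), `χ₂₀(τ₀) = 1`
(`Rat.modNCyclotomicCharacter_eq_one_of_mem_inertia`, `3 ∤ 20`), T0b (`√-3 = i·√3`), and
`E₁[5]` fixed by `I_𝔓` (`smul_geomTorsion_eq_of_mem_inertia`, `E₁` good at `3`).
[SilvermanAEC2009 VII.4.1; NeukirchANT1999 I §9] -/
theorem exists_inertial_elt_mem_inertia :
    ∃ (v : HeightOneSpectrum (𝓞 ℚ)) (_ : ((3 : ℕ) : 𝓞 ℚ) ∈ v.asIdeal)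
      (𝔓 : Ideal (absIntegers (𝓞 ℚ) ℚ)) (_ : 𝔓 ∈ v.primesAbove)
      (τ₀ : Field.absoluteGaloisGroup ℚ) (_ : τ₀ ∈ 𝔓.inertia (Field.absoluteGaloisGroup ℚ)),
      (∀ s : AlgebraicClosure ℚ, s ^ 2 = -3 → τ₀ • s = -s) ∧
      (∀ z : AlgebraicClosure ℚ, z ^ 20 = 1 → τ₀ • z = z) ∧
      ∀ P : E₁.geomTorsion 5, τ₀ • P = P := by
  sorry

/-- the determinant form on `𝔽₅²` (verbatim g5) -/
def det2 (u v : Fin 2 → ZMod 5) : ZMod 5 := u 0 * v 1 - u 1 * v 0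

/-- W1 (M−, verbatim g5): the Weil pairing in a frame is `ζ^{det}`. [SilvermanAEC2009 III.8.1] -/
theorem weilPairing_eq_pow_det_of_frame (E : WeierstrassCurve ℚ) [E.IsElliptic]
    (e₁ : E.geomTorsion 5 ≃+ (Fin 2 → ZMod 5)) :
    ∃ ζ : AlgebraicClosure ℚ, IsPrimitiveRoot ζ 5 ∧
      ∀ P Q : E.geomTorsion 5,
        weilPairingFun (W := E) (m := 5) (by norm_num) (P : E.geomPoints) Q =
          ζ ^ (det2 (e₁ P) (e₁ Q)).val := by
  sorry

/-- W2 (XS, verbatim g5). [folklore] -/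
theorem exists_unit_pow_eq {ζ ζ' : AlgebraicClosure ℚ} (hζ : IsPrimitiveRoot ζ 5)
    (hζ' : IsPrimitiveRoot ζ' 5) : ∃ k : (ZMod 5)ˣ, ζ' = ζ ^ ((k : ZMod 5)).val := by
  sorry

/-- W3a (XS, verbatim g5). [folklore] -/
theorem exists_addEquiv_of_gl {E E' : WeierstrassCurve ℚ} (e₁ : E.geomTorsion 5 ≃+ (Fin 2 → ZMod 5))
    (e₁' : E'.geomTorsion 5 ≃+ (Fin 2 → ZMod 5)) (C : GL (Fin 2) (ZMod 5)) :
    ∃ e : E'.geomTorsion 5 ≃+ E.geomTorsion 5,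
      ∀ P, e₁ (e P) = Matrix.mulVec (C : Matrix (Fin 2) (Fin 2) (ZMod 5)) (e₁' P) := by
  sorry

/-- W3c (S, verbatim g5). [Fisher2012Hessian Def 13.1; folklore] -/
theorem weil_compat_of_det_eq {E E' : WeierstrassCurve ℚ} [E.IsElliptic] [E'.IsElliptic]
    {e₁ : E.geomTorsion 5 ≃+ (Fin 2 → ZMod 5)} {e₁' : E'.geomTorsion 5 ≃+ (Fin 2 → ZMod 5)}
    {ζ ζ' : AlgebraicClosure ℚ} (hζ5 : ζ ^ 5 = 1)
    (hw : ∀ P Q : E.geomTorsion 5,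
      weilPairingFun (W := E) (m := 5) (by norm_num) (P : E.geomPoints) Q = ζ ^ (det2 (e₁ P) (e₁ Q)).val)
    (hw' : ∀ P Q : E'.geomTorsion 5,
      weilPairingFun (W := E') (m := 5) (by norm_num) (P : E'.geomPoints) Q = ζ' ^ (det2 (e₁' P) (e₁' Q)).val)
    {k : (ZMod 5)ˣ} (hk : ζ' = ζ ^ ((k : ZMod 5)).val) {C : GL (Fin 2) (ZMod 5)}
    (hdet : Matrix.GeneralLinearGroup.det C = k) {e : E'.geomTorsion 5 ≃+ E.geomTorsion 5}
    (he : ∀ P, e₁ (e P) = Matrix.mulVec (C : Matrix (Fin 2) (Fin 2) (ZMod 5)) (e₁' P)) :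
    ∀ P Q : E'.geomTorsion 5,
      weilPairingFun (W := E) (m := 5) (by norm_num) (e P : E.geomPoints) (e Q) =
        weilPairingFun (W := E') (m := 5) (by norm_num) (P : E'.geomPoints) Q := by
  sorry

/-- **SYMP (PROVED from W1, W2, W3a, W3c; no Galois input): any two elliptic curves over `ℚ` admit
a SYMPLECTIC additive isomorphism `E'[5] ≃ E[5]`** (g5's G4a without the equivariance clause and
without W3b/T1/T2/SL₂-trichotomy). -/
theorem exists_symplectic_addEquiv (E E' : WeierstrassCurve ℚ) [E.IsElliptic] [E'.IsElliptic] :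
    ∃ e : E'.geomTorsion 5 ≃+ E.geomTorsion 5, ∀ P Q : E'.geomTorsion 5,
      weilPairingFun (W := E) (m := 5) (by norm_num) (e P : E.geomPoints) (e Q) =
        weilPairingFun (W := E') (m := 5) (by norm_num) (P : E'.geomPoints) Q := by
  haveI : Fact (Nat.Prime 5) := ⟨Nat.prime_five⟩
  haveI : NeZero ((5 : ℕ) : ℚ) := ⟨by norm_num⟩
  obtain ⟨ρ, e₁, -⟩ := E.exists_isTorsionGaloisRep 5
  obtain ⟨ρ', e₁', -⟩ := E'.exists_isTorsionGaloisRep 5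
  obtain ⟨ζ, hζ, hw⟩ := weilPairing_eq_pow_det_of_frame E e₁
  obtain ⟨ζ', hζ', hw'⟩ := weilPairing_eq_pow_det_of_frame E' e₁'
  obtain ⟨k, hk⟩ := exists_unit_pow_eq hζ hζ'
  obtain ⟨C, hdet⟩ := Matrix.GeneralLinearGroup.det_surjective (n := Fin 2) (R := ZMod 5) k
  obtain ⟨e, he⟩ := exists_addEquiv_of_gl e₁ e₁' C
  exact ⟨e, weil_compat_of_det_eq hζ.pow_eq_one hw hw' hk hdet he⟩

/-- **G4c′ (S; g4's G4c with the sharper output `t₁ ∈ K`).**  Apply `Thm132iiMemHesseFamily` over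
`K`: `E' ≅_{ℚ̄} E_{l,m}`, `l, m ∈ K`; `c₆(E') = 0 ⇒ 𝔠₆(l,m) = 0`, `c₄(E') ≠ 0 ⇒ 𝔠₄(l,m) ≠ 0`,
`m ≠ 0` (`C6_one_zero` + homogeneity), `t₁ := l/m ∈ K`. [Fisher2012Hessian Thm 13.2, §8] -/
theorem exists_root_mem_of_memHesse (hFii : Thm132iiMemHesseFamily) (c₄ c₆ : ℤ) (h6 : c₆ ≠ 0)
    [(base (c₄ : ℚ) c₆).IsElliptic] (E' : WeierstrassCurve ℚ) [E'.IsElliptic] (hj : E'.c₆ = 0)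
    (K : IntermediateField ℚ (AlgebraicClosure ℚ))
    (e : E'.geomTorsion 5 ≃+ (base (c₄ : ℚ) c₆).geomTorsion 5)
    (hKe : ∀ γ : Field.absoluteGaloisGroup ℚ, (∀ x : AlgebraicClosure ℚ, x ∈ K → γ • x = x) →
      ∀ P : E'.geomTorsion 5, e (γ • P) = γ • e P)
    (hweil : ∀ P Q : E'.geomTorsion 5,
      weilPairingFun (W := base (c₄ : ℚ) c₆) (m := 5) (by norm_num)
          (e P : (base (c₄ : ℚ) c₆).geomPoints) (e Q) =
        weilPairingFun (W := E') (m := 5) (by norm_num) (P : E'.geomPoints) Q) :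
    ∃ t₁ ∈ K, C6 (c₄ : AlgebraicClosure ℚ) c₆ t₁ 1 = 0 ∧ C4 (c₄ : AlgebraicClosure ℚ) c₆ t₁ 1 ≠ 0 := by
  sorry

/-- g4's G4c is a corollary (PROVED). -/
theorem exists_fixed_root_of_memHesse (hFii : Thm132iiMemHesseFamily) (c₄ c₆ : ℤ) (h6 : c₆ ≠ 0)
    [(base (c₄ : ℚ) c₆).IsElliptic] (E' : WeierstrassCurve ℚ) [E'.IsElliptic] (hj : E'.c₆ = 0)
    (K : IntermediateField ℚ (AlgebraicClosure ℚ))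
    (e : E'.geomTorsion 5 ≃+ (base (c₄ : ℚ) c₆).geomTorsion 5)
    (hKe : ∀ γ : Field.absoluteGaloisGroup ℚ, (∀ x : AlgebraicClosure ℚ, x ∈ K → γ • x = x) →
      ∀ P : E'.geomTorsion 5, e (γ • P) = γ • e P)
    (hweil : ∀ P Q : E'.geomTorsion 5,
      weilPairingFun (W := base (c₄ : ℚ) c₆) (m := 5) (by norm_num)
          (e P : (base (c₄ : ℚ) c₆).geomPoints) (e Q) =
        weilPairingFun (W := E') (m := 5) (by norm_num) (P : E'.geomPoints) Q)
    (σ : Field.absoluteGaloisGroup ℚ) (hσK : ∀ x : AlgebraicClosure ℚ, x ∈ K → σ • x = x) :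
    ∃ t₁ : AlgebraicClosure ℚ, C6 (c₄ : AlgebraicClosure ℚ) c₆ t₁ 1 = 0 ∧
      C4 (c₄ : AlgebraicClosure ℚ) c₆ t₁ 1 ≠ 0 ∧ σ • t₁ = t₁ := by
  obtain ⟨t₁, ht₁K, ht6, ht4⟩ := exists_root_mem_of_memHesse hFii c₄ c₆ h6 E' hj K e hKe hweil
  exact ⟨t₁, ht6, ht4, hσK t₁ ht₁K⟩

/-! ### 2f. the fast lane, composed (PROVED from FL2, SYMP, G4c′ and the PROVED FL1/DIV/SUPFIX) -/

/-- **FAST LANE (PROVED composition): in the semistable-at-`3` regime the core needs no twists.**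
`σ := τ₀⁵` (`τ₀ ∈ I₃` from FL2) is trivial on `W[5]` (FL1) and on `E₁[5]`, hence fixes
`K₀ = ℚ(W[5], E₁[5])` pointwise (DIV2 + SUPFIX); every symplectic `e : E₁[5] ≃ W[5]` (SYMP) is
`Γ_{K₀}`-equivariant (DIV1); Fisher 13.2(ii) over `K₀` (G4c′) gives a root `t₁ ∈ K₀`; and `σ` still
negates `√-3` (odd power) and fixes `μ₄`. -/
theorem core1728At_of_fastLane (hFii : Thm132iiMemHesseFamily) (c₄ c₆ : ℤ) (h6 : c₆ ≠ 0)
    [(base (c₄ : ℚ) c₆).IsElliptic]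
    (hss : ∀ v : HeightOneSpectrum (𝓞 ℚ), ((3 : ℕ) : 𝓞 ℚ) ∈ v.asIdeal →
      (base (c₄ : ℚ) c₆).IsSemistableAt v) :
    Core1728At c₄ c₆ := by
  obtain ⟨v, hv3, 𝔓, h𝔓, τ₀, hτ₀, hs, hz, h₁⟩ := exists_inertial_elt_mem_inertia
  have hW : ∀ P : (base (c₄ : ℚ) c₆).geomTorsion 5, τ₀ ^ 5 • P = P :=
    pow_five_smul_eq_of_isSemistableAt (base (c₄ : ℚ) c₆) hv3 (hss v hv3) h𝔓 hτ₀
  have hE : ∀ P : E₁.geomTorsion 5, τ₀ ^ 5 • P = P := fun P => pow_smul_eq_of_smul_eq (h₁ P) 5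
  obtain ⟨e, hweil⟩ := exists_symplectic_addEquiv (base (c₄ : ℚ) c₆) E₁
  have hKe : ∀ γ : Field.absoluteGaloisGroup ℚ,
      (∀ x : AlgebraicClosure ℚ, x ∈ (base (c₄ : ℚ) c₆).divisionField 5 ⊔ E₁.divisionField 5 →
        γ • x = x) → ∀ P : E₁.geomTorsion 5, e (γ • P) = γ • e P := by
    intro γ hγ P
    have hγE : γ • P = P :=
      smul_torsion_eq_of_fixes_divisionField E₁ (fun x hx => hγ x
        ((le_sup_right : E₁.divisionField 5 ≤ (base (c₄ : ℚ) c₆).divisionField 5 ⊔ E₁.divisionField 5) hx)) P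
    have hγW : γ • e P = e P :=
      smul_torsion_eq_of_fixes_divisionField (base (c₄ : ℚ) c₆) (fun x hx => hγ x
        ((le_sup_left : (base (c₄ : ℚ) c₆).divisionField 5 ≤
          (base (c₄ : ℚ) c₆).divisionField 5 ⊔ E₁.divisionField 5) hx)) (e P)
    rw [hγE, hγW]
  have hE₁c₆ : E₁.c₆ = 0 := by
    norm_num [E₁, WeierstrassCurve.c₆, WeierstrassCurve.b₂, WeierstrassCurve.b₄, WeierstrassCurve.b₆]
  obtain ⟨t₁, ht₁K, ht6, ht4⟩ :=
    exists_root_mem_of_memHesse hFii c₄ c₆ h6 E₁ hE₁c₆ _ e hKe hweil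
  refine ⟨τ₀ ^ 5, t₁, fun s hs2 => pow_five_smul_neg (hs s hs2),
    fun z hz4 => pow_smul_eq_of_smul_eq (hz z ?_) 5, ht6, ht4, ?_⟩
  · rw [show (20 : ℕ) = 4 * 5 from rfl, pow_mul, hz4, one_pow]
  · exact smul_eq_of_mem_sup
      (fixes_divisionField_of_smul_torsion_eq (base (c₄ : ℚ) c₆) hW)
      (fixes_divisionField_of_smul_torsion_eq E₁ hE) ht₁K

/-- The fast lane feeds `Core1728` on the semistable-at-`3` locus (PROVED restatement). -/
theorem core1728_on_semistable_locus (hFii : Thm132iiMemHesseFamily) :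
    ∀ (c₄ c₆ : ℤ), c₄ ^ 3 ≠ c₆ ^ 2 → c₆ ≠ 0 → ∀ [(base (c₄ : ℚ) c₆).IsElliptic],
      (∀ v : HeightOneSpectrum (𝓞 ℚ), ((3 : ℕ) : 𝓞 ℚ) ∈ v.asIdeal →
        (base (c₄ : ℚ) c₆).IsSemistableAt v) → Core1728At c₄ c₆ :=
  fun c₄ c₆ _ h6 _ hss => core1728At_of_fastLane hFii c₄ c₆ h6 hss

/-! ## §3 The (ii) debt as ONE field-generic named fact (Fisher: perfect field, `char ∤ 6n = 30`) -/

/-- Fisher's base model over a field (verbatim k1-g5). -/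
abbrev baseF {F : Type u} [Field F] (c₄ c₆ : F) : WeierstrassCurve F := ⟨0, 0, 0, -27 * c₄, -54 * c₆⟩

/-- The Hesse member over a field (verbatim k1-g5). -/
abbrev memberF {F : Type u} [Field F] (c₄ c₆ l m : F) : WeierstrassCurve F :=
  ⟨0, 0, 0, -27 * C4 c₄ c₆ l m, -54 * C6 c₄ c₆ l m⟩

/-- Direct `5`-congruence over a field (verbatim k1-g5; [Fisher2012Hessian] Def. 13.1). -/
def DirectCongrFive {F : Type u} [Field F] (W₁ W₂ : WeierstrassCurve F) [W₁.IsElliptic] [W₂.IsElliptic]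
    (h5 : ((5 : ℕ) : F) ≠ 0) : Prop :=
  ∃ e : W₁.geomTorsion 5 ≃+ W₂.geomTorsion 5,
    (∀ (σ : absoluteGaloisGroup F) (P : W₁.geomTorsion 5), e (σ • P) = σ • e P) ∧
    ∀ P Q : W₁.geomTorsion 5,
      weilPairingFun h5 ((e P : W₂.geomTorsion 5) : W₂.geomPoints) ((e Q : W₂.geomTorsion 5) : W₂.geomPoints)
        = weilPairingFun h5 (P : W₁.geomPoints) (Q : W₁.geomPoints)

/-- k1's named fact (verbatim k1-g5): Fisher 13.2 (ii) over `𝔽_q`. [Fisher2012Hessian, Thm 13.2] -/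
def Thm132iiPrimeField : Prop :=
  ∀ (q : ℕ) [Fact q.Prime], 7 ≤ q → ∀ (h5 : ((5 : ℕ) : ZMod q) ≠ 0)
    (E E' : WeierstrassCurve (ZMod q)) [E.IsElliptic] [E'.IsElliptic] (c₄ c₆ : ZMod q),
    E = baseF c₄ c₆ → DirectCongrFive E E' h5 →
      ∃ (l m : ZMod q) (C : VariableChange (ZMod q)), C • E' = memberF c₄ c₆ l m

/-- **Thm132iiField (the ONE vendoring target, gen 6): Fisher 2012 Thm 13.2 (ii) for `n = 5` over
any PERFECT field `F` with `30 ≠ 0` in `F`** ("we work over a perfect field `K` of characteristic not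
dividing `6n`", p. 4; Thm 13.2: `E'/K` directly `5`-congruent to `E : y² = x³ − 27c₄x − 54c₆` iff
`E' ≅_K E_{λ,μ}` for some `λ, μ ∈ K`, p. 19).  k1 consumes `F = 𝔽_q` (PROVED instance below), k3
consumes `F = K₀ = ℚ(W[5], E₁[5])` (instance = transport `T_K`, helper `memHesse_of_thm132iiField`).
[Fisher2012Hessian Thm 13.2 (ii); RubinSilverberg1995 Thm 4.1/5.1] -/
def Thm132iiField : Prop :=
  ∀ (F : Type) [Field F] [PerfectField F], (30 : F) ≠ 0 →
    ∀ (h5 : ((5 : ℕ) : F) ≠ 0) (E E' : WeierstrassCurve F) [E.IsElliptic] [E'.IsElliptic] (c₄ c₆ : F),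
    E = baseF c₄ c₆ → DirectCongrFive E E' h5 →
      ∃ (l m : F) (C : VariableChange F), C • E' = memberF c₄ c₆ l m

/-- `q ≥ 7` prime ⇒ `30 ≠ 0` in `𝔽_q` (PROVED). -/
theorem thirty_ne_zero_zmod (q : ℕ) [hq : Fact q.Prime] (h7 : 7 ≤ q) : (30 : ZMod q) ≠ 0 := by
  intro h
  have hdvd : q ∣ 30 := by
    rw [show (30 : ZMod q) = ((30 : ℕ) : ZMod q) by norm_num] at h
    exact (ZMod.natCast_eq_zero_iff 30 q).mp h
  have hp := hq.out
  rw [show (30 : ℕ) = 2 * 3 * 5 from rfl] at hdvd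
  rcases hp.dvd_mul.mp hdvd with h23 | h5
  · rcases hp.dvd_mul.mp h23 with h2 | h3
    · have := (Nat.prime_dvd_prime_iff_eq hp Nat.prime_two).mp h2; omega
    · have := (Nat.prime_dvd_prime_iff_eq hp Nat.prime_three).mp h3; omega
  · have := (Nat.prime_dvd_prime_iff_eq hp Nat.prime_five).mp h5; omega

/-- **k1's instance (PROVED): `Thm132iiField → Thm132iiPrimeField`.** -/
theorem thm132iiPrimeField_of_field (h : Thm132iiField) : Thm132iiPrimeField := by
  intro q _ h7 h5 E E' _ _ c₄ c₆ hE hcongr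
  exact h (ZMod q) (thirty_ne_zero_zmod q h7) h5 E E' c₄ c₆ hE hcongr

/-- **k3's instance (M): `Thm132iiField → Thm132iiMemHesseFamily`** — the transport `T_K`:
`K ⊆ ℚ̄` is perfect (char `0`) with `30 ≠ 0`; base-change `E, E'` to `K`; identify
`(E.baseChange K)[5]` over `K̄ = ℚ̄` with `E[5]` and the `Γ_K`-action with `Γ_ℚ|_{Γ_K}` (tree
`geomPointsEquivBaseChange` / `torsionTransferEquiv`, `WeilPairingBaseChangeCompat`); read the
`K`-isomorphism `C • E'_K = E_{l,m}` in `ℚ̄` (`map_variableChange`). [Fisher2012Hessian Thm 13.2 (ii)] -/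
theorem memHesse_of_thm132iiField (h : Thm132iiField) : Thm132iiMemHesseFamily := by
  sorry

/-! ## sanity: the stub is literally the route's named fact (rfl, as in g4/g5) -/
example : CDT_three_five_switch ↔
    (∀ (W : WeierstrassCurve ℚ) [W.IsElliptic], ¬ 27 ∣ W.conductorNorm ℤ →
      (∀ ρ₃ : ModPGaloisRep ℚ (ZMod 3) 2, W.IsTorsionGaloisRep 3 ρ₃ → ¬ ρ₃.IsAbsIrreducibleOverSqrt (-3)) →
      ∀ (ρ : ModPGaloisRep ℚ (ZMod 5) 2), W.IsTorsionGaloisRep 5 ρ → ρ.IsAbsIrreducibleOverSqrt 5 →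
        ∃ (W' : WeierstrassCurve ℚ) (_ : W'.IsElliptic), W'.IsTorsionGaloisRep 5 ρ ∧
          ∃ ρ₃' : ModPGaloisRep ℚ (ZMod 3) 2, W'.IsTorsionGaloisRep 3 ρ₃' ∧
            ρ₃'.IsAbsIrreducibleOverSqrt (-3)) := Iff.rfl

end Summit.ABC.ABC.Cruxes.FreyModularity.StubSwitchK3g6

end
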